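import Mathlib.RingTheory.Artinian.Module
import Mathlib.FieldTheory.IsAlgClosed.Basic
import Mathlib.FieldTheory.IntermediateField.Basic
import Mathlib.LinearAlgebra.Dimension.StrongRankCondition
import Mathlib.LinearAlgebra.FreeModule.Finite.Basic
import Literature.NumberTheory.LocalFields.PadicFiniteSubextensions
import HarnessLib

/-!
# Reduced finite-dimensional commutative algebras over a field are finite products of fields

Structure theorem (Mathlib `IsArtinianRing.equivPi`, dressed as an `F`-algebra statement) and its
consequence used for finiteness counts: every reduced commutative `F`-algebra `A` of finite
dimension is `F`-isomorphic to a product of at most `finrank F A` intermediate fields of any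
algebraically closed extension `Ω ⊇ F`, each of degree `≤ finrank F A`; hence, if `F` has only
finitely many subextensions of `Ω` of each bounded degree (e.g. a `p`-adic field, tree
`Literature.NumberTheory.LocalFields.finite_setOf_intermediateField_finrank_le`), there are only
finitely many isomorphism classes of such algebras of dimension `≤ N` — witnessed by an explicit
finite family of representatives.

Classical (structure of reduced Artinian rings); pure Mathlib plus the tree's `p`-adic finiteness
theorem for §3. Theorems only: no `def`, no instance, no notation. Motivation (hodgecm, CARTAN-FIN
road of F0P3a-p03): finitely many conjugacy classes of Cartan subgroups of `U(N)` over a `p`-adic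
field, via the étale algebra `K[γ]` of a regular semisimple `γ`. [cite: BombieriGubler2006, Prop 4.5.3]
-/

noncomputable section

open Module

namespace Literature.FieldTheory

universe u v w

variable (F : Type u) [Field F]

/-- A finite-dimensional reduced commutative algebra over a field is, as an `F`-ALGEBRA, the product
of its residue fields at the (finitely many) maximal ideals (Mathlib `IsArtinianRing.equivPi`,
which is stated as an `A`-algebra isomorphism) — the structure theorem for Artin rings in the
reduced case, over a base field. [cite: AtiyahMacdonald1969, Thm 8.7] -/
theorem nonempty_algEquiv_pi_quotient (A : Type v) [CommRing A] [Algebra F A] [IsReduced A]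
    [FiniteDimensional F A] :
    Nonempty (A ≃ₐ[F] ∀ I : MaximalSpectrum A, A ⧸ I.asIdeal) := by
  haveI : IsArtinianRing A := IsArtinianRing.of_finite F A
  refine ⟨AlgEquiv.ofRingEquiv (f := (IsArtinianRing.equivPi A).toRingEquiv) ?_⟩
  intro r
  funext m
  change IsArtinianRing.equivPi A (algebraMap F A r) m = _
  rw [IsArtinianRing.equivPi_apply, Pi.algebraMap_apply, Ideal.Quotient.mk_algebraMap]

/-- In a finite-dimensional commutative algebra over a field the number of maximal ideals is at
most the dimension (reduced case: `A ≃ ∏ A ⧸ 𝔪` and each factor has positive dimension) —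
a consequence of the structure theorem. [cite: AtiyahMacdonald1969, Thm 8.7] -/
theorem natCard_maximalSpectrum_le_finrank (A : Type v) [CommRing A] [Algebra F A] [IsReduced A]
    [FiniteDimensional F A] :
    Nat.card (MaximalSpectrum A) ≤ finrank F A := by
  haveI : IsArtinianRing A := IsArtinianRing.of_finite F A
  haveI : Fintype (MaximalSpectrum A) := Fintype.ofFinite _
  obtain ⟨e⟩ := nonempty_algEquiv_pi_quotient F A
  rw [e.toLinearEquiv.finrank_eq, Module.finrank_pi_fintype, Nat.card_eq_fintype_card,
    ← Finset.card_univ, Finset.card_eq_sum_ones]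
  refine Finset.sum_le_sum fun I _ => ?_
  haveI : Nontrivial (A ⧸ I.asIdeal) :=
    Ideal.Quotient.nontrivial_iff.mpr (Ideal.IsMaximal.ne_top I.isMaximal)
  haveI : Module.Finite F (A ⧸ I.asIdeal) :=
    Module.Finite.of_surjective (Ideal.Quotient.mkₐ F I.asIdeal).toLinearMap
      (Ideal.Quotient.mkₐ_surjective F I.asIdeal)
  exact Module.finrank_pos

/-- Each residue field of a finite-dimensional `F`-algebra has dimension at most `finrank F A`
(linear algebra: the quotient map is surjective). [folklore] -/
private theorem finrank_quotient_le (A : Type v) [CommRing A] [Algebra F A] [FiniteDimensional F A]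
    (I : Ideal A) : finrank F (A ⧸ I) ≤ finrank F A :=
  LinearMap.finrank_le_finrank_of_surjective (f := (Ideal.Quotient.mkₐ F I).toLinearMap)
    (Ideal.Quotient.mkₐ_surjective F I)

/-- **Structure theorem, intermediate-field form.** A reduced finite-dimensional commutative
`F`-algebra `A` is `F`-isomorphic to a product `∏_{i < k} E_i` of intermediate fields of any
algebraically closed extension `Ω ⊇ F`, with `k ≤ finrank F A` factors, each of degree
`≤ finrank F A` (structure theorem for Artin rings, reduced case, plus an embedding of each residue
field into `Ω`). [cite: AtiyahMacdonald1969, Thm 8.7] -/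
theorem exists_algEquiv_pi_intermediateField (A : Type v) [CommRing A] [Algebra F A] [IsReduced A]
    [FiniteDimensional F A] (Ω : Type w) [Field Ω] [Algebra F Ω] [IsAlgClosed Ω] :
    ∃ (k : ℕ) (E : Fin k → IntermediateField F Ω), k ≤ finrank F A ∧
      (∀ i, FiniteDimensional F (E i) ∧ finrank F (E i) ≤ finrank F A) ∧
      Nonempty (A ≃ₐ[F] ∀ i, E i) := by
  haveI : IsArtinianRing A := IsArtinianRing.of_finite F A
  haveI : Fintype (MaximalSpectrum A) := Fintype.ofFinite _
  obtain ⟨e⟩ := nonempty_algEquiv_pi_quotient F A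
  -- residue fields, embedded in `Ω`
  have hfin : ∀ I : MaximalSpectrum A, Module.Finite F (A ⧸ I.asIdeal) := fun I =>
    Module.Finite.of_surjective (Ideal.Quotient.mkₐ F I.asIdeal).toLinearMap
      (Ideal.Quotient.mkₐ_surjective F I.asIdeal)
  letI fld : ∀ I : MaximalSpectrum A, Field (A ⧸ I.asIdeal) := fun I =>
    Ideal.Quotient.field I.asIdeal
  have φ : ∀ I : MaximalSpectrum A, (A ⧸ I.asIdeal) →ₐ[F] Ω := fun I =>
    haveI := hfin I
    IsAlgClosed.lift
  set k := Fintype.card (MaximalSpectrum A) with hk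
  let σ : MaximalSpectrum A ≃ Fin k := Fintype.equivFin _
  let E : Fin k → IntermediateField F Ω := fun i => (φ (σ.symm i)).fieldRange
  refine ⟨k, E, ?_, ?_, ?_⟩
  · rw [hk, ← Nat.card_eq_fintype_card]; exact natCard_maximalSpectrum_le_finrank F A
  · intro i
    haveI := hfin (σ.symm i)
    have eI : (A ⧸ (σ.symm i).asIdeal) ≃ₐ[F] E i := (φ (σ.symm i)).equivFieldRange
    haveI : FiniteDimensional F (E i) := Module.Finite.equiv eI.toLinearEquiv
    exact ⟨this, by rw [← eI.toLinearEquiv.finrank_eq]; exact finrank_quotient_le F A _⟩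
  · -- `A ≃ ∏_I A⧸I ≃ ∏_I E (σ I) ≃ ∏_i E i`
    have e1 : (∀ I : MaximalSpectrum A, A ⧸ I.asIdeal) ≃ₐ[F]
        ∀ I : MaximalSpectrum A, E (σ I) :=
      AlgEquiv.piCongrRight fun I => by
        haveI := hfin I
        have h : E (σ I) = (φ I).fieldRange := by
          simp only [E]; rw [Equiv.symm_apply_apply]
        exact (φ I).equivFieldRange.trans (IntermediateField.equivOfEq h.symm)
    have e2 : (∀ I : MaximalSpectrum A, (fun i => (E i : Type w)) (σ I)) ≃ₐ[F] ∀ i : Fin k, E i :=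
      AlgEquiv.piCongrLeft F (fun i : Fin k => (E i : Type w)) σ
    exact ⟨(e.trans e1).trans e2⟩

/-- **Finitely many isomorphism classes.** If `F` has only finitely many subextensions of `Ω` of
each bounded degree (`Ω ⊇ F` algebraically closed), then for every `N` there is a FINITE family of
commutative `F`-algebras `R i` such that every reduced commutative `F`-algebra of dimension `≤ N`
is `F`-isomorphic to some `R i`. The family: products `∏_{i<k} E_i`, `k ≤ N`, of subextensions of
degree `≤ N` (structure theorem + counting). [cite: AtiyahMacdonald1969, Thm 8.7] -/
theorem exists_finite_representatives_of_finite_intermediateField (Ω : Type w) [Field Ω]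
    [Algebra F Ω] [IsAlgClosed Ω]
    (hfin : ∀ d : ℕ, {E : IntermediateField F Ω | FiniteDimensional F E ∧ finrank F E ≤ d}.Finite)
    (N : ℕ) :
    ∃ (ι : Type w) (_ : Finite ι) (R : ι → Type w) (_ : ∀ i, CommRing (R i))
      (_ : ∀ i, Algebra F (R i)),
      ∀ (A : Type v) [CommRing A] [Algebra F A] [IsReduced A] [FiniteDimensional F A],
        finrank F A ≤ N → ∃ i, Nonempty (A ≃ₐ[F] R i) := by
  -- index: `k ≤ N` and a `k`-tuple of subextensions of degree `≤ N`
  let T : Set (IntermediateField F Ω) :=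
    {E | FiniteDimensional F E ∧ finrank F E ≤ N}
  haveI hT : Finite T := (hfin N).to_subtype
  let ι : Type w := Σ k : Fin (N + 1), (Fin k → T)
  haveI : Finite ι := inferInstance
  refine ⟨ι, this, fun p => ∀ i : Fin p.1, ((p.2 i : IntermediateField F Ω) : Type w),
    fun p => inferInstance, fun p => inferInstance, ?_⟩
  intro A _ _ _ _ hA
  obtain ⟨k, E, hk, hE, ⟨e⟩⟩ := exists_algEquiv_pi_intermediateField F A Ω
  have hkN : k < N + 1 := Nat.lt_succ_of_le (hk.trans hA)
  refine ⟨⟨⟨k, hkN⟩, fun i => ⟨E i, (hE i).1, (hE i).2.trans hA⟩⟩, ⟨?_⟩⟩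
  exact e

/-! ## Changing the base field along a finite extension; `p`-adic fields -/

/-- Finiteness of the bounded-degree subextensions DESCENDS along a finite extension of the base:
if `F ⊆ K ⊆ Ω` with `[K:F] < ∞` and `Ω/F` has finitely many intermediate fields of each bounded
`F`-degree, then `Ω/K` has finitely many intermediate fields of each bounded `K`-degree
(`E ↦ E` viewed over `F` is injective and multiplies degrees by `[K:F]`) — the reduction used in
the proof that a `p`-adic field has finitely many extensions of bounded degree.
[cite: BombieriGubler2006, Prop 4.5.3] -/
theorem finite_setOf_intermediateField_finrank_le_of_tower (K : Type v) [Field K] [Algebra F K]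
    [FiniteDimensional F K] (Ω : Type w) [Field Ω] [Algebra F Ω] [Algebra K Ω] [IsScalarTower F K Ω]
    (hfin : ∀ d : ℕ, {E : IntermediateField F Ω | FiniteDimensional F E ∧ finrank F E ≤ d}.Finite)
    (d : ℕ) :
    {E : IntermediateField K Ω | FiniteDimensional K E ∧ finrank K E ≤ d}.Finite := by
  refine Set.Finite.of_finite_image (f := IntermediateField.restrictScalars F) ?_
    (IntermediateField.restrictScalars_injective F).injOn
  refine (hfin (finrank F K * d)).subset ?_
  rintro _ ⟨E, ⟨hE, hd⟩, rfl⟩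
  haveI := hE
  -- the same carrier, as an `F`-space
  let e : E ≃ₗ[F] (E.restrictScalars F) :=
    { toFun := fun x => ⟨x.1, x.2⟩, invFun := fun x => ⟨x.1, x.2⟩, map_add' := fun _ _ => rfl,
      map_smul' := fun _ _ => rfl, left_inv := fun _ => rfl, right_inv := fun _ => rfl }
  haveI : FiniteDimensional F E := Module.Finite.trans K E
  refine ⟨Module.Finite.equiv e, ?_⟩
  rw [← e.finrank_eq, ← Module.finrank_mul_finrank F K E]
  exact Nat.mul_le_mul_left _ hd

/-- Every `p`-adic field `K` (a finite extension of `ℚ_p`), realised inside `Q̄_p = PadicAlgCl p`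
compatibly with `ℚ_p`, has only finitely many subextensions of `Q̄_p` of each bounded degree —
from the tree's theorem over `ℚ_p`
(`Literature.NumberTheory.LocalFields.finite_setOf_intermediateField_finrank_le`) by descent
along `ℚ_p ⊆ K`. [cite: BombieriGubler2006, Prop 4.5.3] -/
theorem finite_setOf_intermediateField_finrank_le_padicAlgCl (p : ℕ) [Fact p.Prime]
    (K : Type v) [Field K] [Algebra ℚ_[p] K] [FiniteDimensional ℚ_[p] K]
    [Algebra K (PadicAlgCl p)] [IsScalarTower ℚ_[p] K (PadicAlgCl p)] (d : ℕ) :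
    {E : IntermediateField K (PadicAlgCl p) | FiniteDimensional K E ∧ finrank K E ≤ d}.Finite :=
  finite_setOf_intermediateField_finrank_le_of_tower ℚ_[p] K (PadicAlgCl p)
    (Literature.NumberTheory.LocalFields.finite_setOf_intermediateField_finrank_le p) d

/-- **Finitely many reduced commutative algebras of bounded dimension over a `p`-adic field.**
For every field `K` finite over `ℚ_p` and every `N` there is a FINITE family of commutative
`K`-algebras `R i` such that every reduced (equivalently, since `char K = 0`, étale) commutative
`K`-algebra of dimension `≤ N` is `K`-isomorphic to one of them. No embedding of `K` into `Q̄_p`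
is assumed: one is chosen inside the proof (`IsAlgClosed.lift`). Consequence of the finiteness of
extensions of bounded degree and the structure theorem for reduced Artin rings.
[cite: BombieriGubler2006, Prop 4.5.3] [cite: AtiyahMacdonald1969, Thm 8.7] -/
theorem exists_finite_representatives_padic (p : ℕ) [Fact p.Prime] (K : Type u) [Field K]
    [Algebra ℚ_[p] K] [FiniteDimensional ℚ_[p] K] (N : ℕ) :
    ∃ (ι : Type) (_ : Finite ι) (R : ι → Type) (_ : ∀ i, CommRing (R i))
      (_ : ∀ i, Algebra K (R i)),
      ∀ (A : Type v) [CommRing A] [Algebra K A] [IsReduced A] [FiniteDimensional K A],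
        finrank K A ≤ N → ∃ i, Nonempty (A ≃ₐ[K] R i) := by
  let ψ : K →ₐ[ℚ_[p]] PadicAlgCl p := IsAlgClosed.lift
  letI : Algebra K (PadicAlgCl p) := ψ.toRingHom.toAlgebra
  haveI : IsScalarTower ℚ_[p] K (PadicAlgCl p) :=
    IsScalarTower.of_algebraMap_eq fun r => by
      rw [RingHom.algebraMap_toAlgebra]; exact (ψ.commutes r).symm
  exact exists_finite_representatives_of_finite_intermediateField K (PadicAlgCl p)
    (finite_setOf_intermediateField_finrank_le_padicAlgCl p K) N


/-! ## ED. 2 appendix: transfer along an isomorphism of the top field; `hfin` over `AlgebraicClosure K`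

Consumers that state the finiteness hypothesis over Mathlib's ABSTRACT algebraic closure
`AlgebraicClosure K` (e.g. ★ `Rogawski1990/CartanAlgebraTypesFinite`) need it discharged there for a
`p`-adic `K`: any two algebraic closures are `K`-isomorphic (`IsAlgClosure.equiv`), and the set of
bounded-degree subextensions is transported along a `K`-isomorphism of the top fields. -/

/-- Finiteness of the bounded-degree subextensions is invariant under a `K`-algebra isomorphism of
the top fields (`IntermediateField.map` is injective and preserves degrees).
[cite: BombieriGubler2006, Prop 4.5.3] -/
theorem finite_setOf_intermediateField_finrank_le_of_algEquiv {Ω : Type v} {Ω' : Type w} [Field Ω]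
    [Field Ω'] [Algebra F Ω] [Algebra F Ω'] (e : Ω ≃ₐ[F] Ω')
    (hfin : ∀ d : ℕ, {E : IntermediateField F Ω' | FiniteDimensional F E ∧ finrank F E ≤ d}.Finite)
    (d : ℕ) :
    {E : IntermediateField F Ω | FiniteDimensional F E ∧ finrank F E ≤ d}.Finite := by
  have hinj : Set.InjOn (IntermediateField.map (e : Ω →ₐ[F] Ω'))
      (IntermediateField.map (e : Ω →ₐ[F] Ω') ⁻¹'
        {E : IntermediateField F Ω' | FiniteDimensional F E ∧ finrank F E ≤ d}) :=
    (IntermediateField.map_injective _).injOn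
  refine ((hfin d).preimage hinj).subset ?_
  rintro E ⟨hE, hd⟩
  haveI := hE
  let eE := IntermediateField.equivMap E (e : Ω →ₐ[F] Ω')
  refine ⟨Module.Finite.equiv eE.toLinearEquiv, ?_⟩
  rwa [← eE.toLinearEquiv.finrank_eq]

/-- **`hfin` over the abstract algebraic closure of a `p`-adic field**: for `K` finite over `ℚ_p`,
the intermediate fields `K ⊆ E ⊆ AlgebraicClosure K` of `K`-degree `≤ d` form a finite set — from
the `Q̄_p` statement (`finite_setOf_intermediateField_finrank_le_padicAlgCl`) along a `K`-isomorphism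
`AlgebraicClosure K ≃ₐ[K] Q̄_p` (`Q̄_p` is an algebraic closure of `K`). This discharges the
hypothesis `hfin` of ★ `Rogawski1990.exists_finset_cartanAlgebra_types` for `p`-adic base fields.
[cite: BombieriGubler2006, Prop 4.5.3] -/
theorem finite_setOf_intermediateField_algebraicClosure_finrank_le_padic (p : ℕ) [Fact p.Prime]
    (K : Type u) [Field K] [Algebra ℚ_[p] K] [FiniteDimensional ℚ_[p] K] (d : ℕ) :
    {E : IntermediateField K (AlgebraicClosure K) |
      FiniteDimensional K E ∧ finrank K E ≤ d}.Finite := by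
  let ψ : K →ₐ[ℚ_[p]] PadicAlgCl p := IsAlgClosed.lift
  letI : Algebra K (PadicAlgCl p) := ψ.toRingHom.toAlgebra
  haveI : IsScalarTower ℚ_[p] K (PadicAlgCl p) :=
    IsScalarTower.of_algebraMap_eq fun r => by
      rw [RingHom.algebraMap_toAlgebra]; exact (ψ.commutes r).symm
  haveI : Algebra.IsAlgebraic K (PadicAlgCl p) := Algebra.IsAlgebraic.tower_top (K := ℚ_[p]) K
  haveI : IsAlgClosure K (PadicAlgCl p) := (isAlgClosure_iff K (PadicAlgCl p)).2 ⟨inferInstance, inferInstance⟩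
  exact finite_setOf_intermediateField_finrank_le_of_algEquiv K
    (IsAlgClosure.equiv K (AlgebraicClosure K) (PadicAlgCl p))
    (finite_setOf_intermediateField_finrank_le_padicAlgCl p K) d

/-- **Unconditional `p`-adic form of the CARTAN-FIN type count's input**: every reduced commutative
algebra statement of this file over a `p`-adic `K` may be read with `Ω = AlgebraicClosure K` — the
pair (`hfin` over `AlgebraicClosure K`, finite representative family there).
[cite: BombieriGubler2006, Prop 4.5.3] [cite: AtiyahMacdonald1969, Thm 8.7] -/
theorem exists_finite_representatives_algebraicClosure_padic (p : ℕ) [Fact p.Prime] (K : Type u)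
    [Field K] [Algebra ℚ_[p] K] [FiniteDimensional ℚ_[p] K] (N : ℕ) :
    ∃ (ι : Type u) (_ : Finite ι) (R : ι → Type u) (_ : ∀ i, CommRing (R i))
      (_ : ∀ i, Algebra K (R i)),
      ∀ (A : Type v) [CommRing A] [Algebra K A] [IsReduced A] [FiniteDimensional K A],
        finrank K A ≤ N → ∃ i, Nonempty (A ≃ₐ[K] R i) :=
  exists_finite_representatives_of_finite_intermediateField K (AlgebraicClosure K)
    (finite_setOf_intermediateField_algebraicClosure_finrank_le_padic p K) N

end Literature.FieldTheory

end
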